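import Summits.CriticalPhenomena.PercolationContinuityZ3.Theorems.PercNearOneGluingNoHeavyLowerTailMajorityGluingQCert3Sound
import Summits.CriticalPhenomena.PercolationContinuityZ3.Theorems.PercNearOneGluingNoHeavyLowerTailMajorityGluingQCertCountK
import HarnessLib

/-!
# «At least `h` of `k` relays cut» from ANY passing DEGREE-3 certificate (lane prim-rate, constants-miner 1, gen 34; NEXT-g35 item 1)

Support file for the closed crux `NoHeavyLowerTail` (stmt-CriticalPhenomena-4575), majority-gluing line; the degree-3 twin of `…QCertCountK`: the percolation
dictionary `…QCertLawK` applied to the base parameters of a `Cert3`, the rows discharged by `row_lawvK`, soundness by `Cert3.sound3`.  **`cut_of_check3_count`**: if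
`c.check3 fuel = true`, `c.base.m = k`, `c.base.fam = 1`, then for every finite weighted graph, hub `a₀`, `k`-set `T` and `δ ≥ 0` bounding the cut probabilities on `T`:
`cD·μ(c.base.h ≤ #{v ∈ T : v ↮ a₀}) ≤ cN·δ`.  So a degree-3 certificate for `(6,4)` below `5/4` (kit j269592: `1.22` feasible) lands as data + `decide +kernel` + this theorem.
No sorries. [cite: VandenbergKahn2001, Thm 1.2 (p. 123)]
-/

noncomputable section

namespace Summit.CriticalPhenomena.PercolationContinuityZ3.Theorems

open MeasureTheory Set
open Literature.Probability.LatticeModels (prodBernoulli)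
open Literature.Probability.Percolation
open scoped Classical

namespace HubOnly
namespace QCert

variable {n k : ℕ}

section AnyK3

variable (c : Cert3) (hm : c.base.m = k) (hfam : c.base.fam = 1)
include hm hfam

/-- **«At least `h` of `k` cut» along a sorted enumeration, for ANY passing degree-3 certificate of case family `1`.** [cite: VandenbergKahn2001, Thm 1.2 (p. 123)] -/
theorem cut_of_check3 (fuel : ℕ) (hc : c.check3 fuel = true) (w : Sym2 (Fin n) → unitInterval) (a₀ : Fin n) (t : Fin k → Fin n)
    (ht : Function.Injective t) (T : Finset (Fin n)) (hT : T = Finset.univ.image t)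
    (hmono : Monotone fun x : Fin k => (prodBernoulli w).real ((openConn a₀ (t x) : Set (BondConfig (Fin n))) ∩
      {ω : BondConfig (Fin n) | c.base.h ≤ (T.filter fun x => ω ∉ (openConn a₀ x : Set (BondConfig (Fin n)))).card}))
    (δ : ℝ) (hδ0 : 0 ≤ δ) (hδ : ∀ x : Fin k, (prodBernoulli w).real (openConn a₀ (t x) : Set (BondConfig (Fin n)))ᶜ ≤ δ) :
    (c.base.cD : ℝ) * (prodBernoulli w).real
        {ω : BondConfig (Fin n) | c.base.h ≤ (T.filter fun x => ω ∉ (openConn a₀ x : Set (BondConfig (Fin n)))).card} ≤ c.base.cN * δ := by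
  have hNV : c.NV = 2 ^ k + 1 := by rw [Cert3.NV, Cert.NV, hm]
  have hD : c.base.D = 2 ^ k := by rw [Cert.D, hm]
  have hv : ∀ i, 0 ≤ lawvK w a₀ t δ i := lawvK_nonneg w a₀ t δ hδ0
  have hWQ : c.checkW3 = true ∧ c.checkQ3 fuel = true := by
    unfold Cert3.check3 at hc
    simpa only [Bool.and_eq_true] using hc
  obtain ⟨_, _, _, _, _, hrows, _⟩ := c.checkW3_spec hWQ.1
  have hsound := c.sound3 fuel hWQ.1 hWQ.2 (lawvK w a₀ t δ) hv
    (by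
      intro x hx
      rw [hm] at hx
      rw [hNV, hD, lawvK_D, linv_lawvK _ _ _ _ _ (margMemK_D c.base hm x), setOf_margMemK c.base hm a₀ t ⟨x, hx⟩]
      exact hδ ⟨x, hx⟩)
    (by
      intro x hx
      rw [hm] at hx
      rw [hNV, linv_lawvK _ _ _ _ _ (eMemK_D c.base hm hfam x), linv_lawvK _ _ _ _ _ (eMemK_D c.base hm hfam (x + 1)),
        setOf_eMemK c.base hm hfam a₀ t ht T hT ⟨x, by omega⟩, setOf_eMemK c.base hm hfam a₀ t ht T hT ⟨x + 1, hx⟩]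
      exact hmono (Fin.mk_le_mk.2 (by omega)))
    (by
      intro ch hch r hr
      rw [hNV]
      exact row_lawvK c.base hm w a₀ t ht δ r.row (hrows ch hch r hr).1)
  rw [hNV, hD, lawvK_D, linv_lawvK _ _ _ _ _ (tMemK_D c.base hm), setOf_tMemK c.base hm a₀ t ht T hT] at hsound
  exact hsound

/-- **«AT LEAST `h` OF `k` RELAYS CUT» FOR ANY PASSING DEGREE-3 CERTIFICATE, counting form** (orientation `v ↮ a₀`; `|T| = k`; `δ ≥ 0` bounds the cut probabilities):
`cD·μ(c.base.h ≤ #{v ∈ T : v ↮ a₀}) ≤ cN·δ`. [cite: VandenbergKahn2001, Thm 1.2 (p. 123)] -/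
theorem cut_of_check3_count (fuel : ℕ) (hc : c.check3 fuel = true) (w : Sym2 (Fin n) → unitInterval) (a₀ : Fin n) (T : Finset (Fin n))
    (hT : T.card = k) (δ : ℝ) (hδ0 : 0 ≤ δ) (hδ : ∀ v ∈ T, (prodBernoulli w).real (openConn v a₀ : Set (BondConfig (Fin n)))ᶜ ≤ δ) :
    (c.base.cD : ℝ) * (prodBernoulli w).real {ω : BondConfig (Fin n) | c.base.h ≤ (T.filter fun v => ω ∉ openConn v a₀).card} ≤
      c.base.cN * δ := by
  have hδ' : ∀ x ∈ T, (prodBernoulli w).real (openConn a₀ x : Set (BondConfig (Fin n)))ᶜ ≤ δ := by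
    intro x hx; rw [knThm2_openConn_comm]; exact hδ x hx
  have hset : {ω : BondConfig (Fin n) | c.base.h ≤ (T.filter fun v => ω ∉ openConn v a₀).card} =
      {ω : BondConfig (Fin n) | c.base.h ≤ (T.filter (fun x => ω ∉ (openConn a₀ x : Set (BondConfig (Fin n))))).card} := by
    ext ω
    simp only [mem_setOf_eq]
    rw [Finset.filter_congr (fun v _ => by rw [knThm2_openConn_comm v a₀])]
  rw [hset]
  obtain ⟨t, ht, hTt, hmono⟩ := exists_sorted_enumK T hT (fun v => (prodBernoulli w).real
    ((openConn a₀ v : Set (BondConfig (Fin n))) ∩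
      {ω : BondConfig (Fin n) | c.base.h ≤ (T.filter fun x => ω ∉ (openConn a₀ x : Set (BondConfig (Fin n)))).card}))
  exact cut_of_check3 c hm hfam fuel hc w a₀ t ht T hTt hmono δ hδ0 fun x =>
    hδ' (t x) (by rw [hTt]; exact Finset.mem_image_of_mem _ (Finset.mem_univ _))

end AnyK3

end QCert
end HubOnly

end Summit.CriticalPhenomena.PercolationContinuityZ3.Theorems

end
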